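import Literature.AnabelianGeometry.EtaleTheta.Discharge.Sec5Thm510iiiUniversalClosureRefuted

/-!
# [EtTh] §5, Theorem 5.10 (iii) at the degenerate §5 datum: the typed statement ⟺ "the lift of `ψY` normalises `D`"; it HOLDS for every admissible `ψY` when `DK = ∅` or `DK = Out(E^Π_N)` (p. 334 / PDF p. 108)

Mochizuki, *The étale theta function and its Frobenioid-theoretic manifestations*, Publ. RIMS **45**
(2009) [cite: MochizukiEtTh2009, Thm 5.10 (iii) p.334 (PDF p.108)].  abc-iut cell, block F (fact-proving wave),
seat abc-iut-f-123 (tranche 123); PROOF-ONLY companion (one auxiliary construction `liftEnv` + theorems) of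
abc-iut-L2-t4's `FrobenioidMonoThetaEnv.lean` (FACT-LIST **F-0547** `ThetaFrobenioid.MonoThetaEnvCompat`, [EtTh]
Thm. 5.10 (iii)) and of this seat's `Sec5Thm510iiiUniversalClosureRefuted.lean` (p432975: the universal closure of
`MonoThetaEnvCompat` FAILS at abc-iut-f-115's degenerate datum `Sec5Toy.datum` for `DK := {[negB]}`, `ψY := shear`).

This file LOCATES that failure.  At `Sec5Toy.datum` (`Aut_C(B_N) = Aut_D(B_N^bs) = 1`, `Π^tp_X̲ = ℤ³` abelian and
discrete, `E^Π_N ≅ Π^tp_Y̲ ≅ ℤ²`):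
* `Sec5Toy.liftEnv ψY hY` — every `ψY` stabilising `Π^tp_Y̲` lifts UNIQUELY to a bi-continuous automorphism of
  `E^Π_N` (`(1, y) ↦ (1, ψY y)`); by `EPiN_ext` any `γ` as in the typed statement has `γ.e = liftEnv ψY hY`
  (`Sec5Toy.iso_e_eq_liftEnv`);
* `Sec5Toy.conjOut_eq_one`, `Sec5Toy.frdD_eq_closure` — the outer actions `galOut` (Lemma 5.9 (iii)) and `constOut`
  (Lemma 5.8) are TRIVIAL there, so `D = ⟨galOut ∪ constOut ∪ DK⟩ = ⟨DK⟩`: at this datum `D` IS the free Kummer part;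
* `Sec5Toy.muConjClass_eq_singleton`, `Sec5Toy.mem_range_sCupPi_iff`, `Sec5Toy.map_range_sCupPi_liftEnv` — the
  `μ_N`-conjugacy class `s^Θ` is the single subgroup `{x | x̄ ∈ Π^tp_Ÿ̲}`, preserved by the lift of any `ψY`
  stabilising `Π^tp_Ÿ̲`;
* **`Sec5Toy.monoThetaEnvCompat_datum_iff`** — for ALL §5 inputs, `DK`, `Ψ`, `β` and every admissible `ψY`
  (`hbase` is automatic, `hbase_datum`): the typed Thm. 5.10 (iii) statement holds IFF
  `⟨DK⟩.map (Out-transport along liftEnv ψY) = ⟨DK⟩`, i.e. iff the lift of `ψY` normalises the free Kummer part;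
* **`Sec5Toy.monoThetaEnvCompat_datum_empty`**, **`Sec5Toy.monoThetaEnvCompat_datum_univ`** — hence it HOLDS for
  EVERY admissible `ψY` when `DK = ∅` (print's `D`: no free part) and when `DK = Out(E^Π_N)`; together with
  p432975 (`DK := {[negB]}`, `ψY := shear`: fails) the counterexample to the ∀-closure is carried EXACTLY by the
  free parameter `DK` — the typer's documented `TODO-merge(abc-iut-L2-t3)` placeholder for the `K^×`-part of `D`
  (RQ7 finding F1 of abc-iut-L6-t23), not by `Ψ`, `β`, `ψY` or the §5 inputs.  REPAIR READING (for the planner /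
  typer, no item filed here): constrain `DK` to the image of the Kummer map (abc-iut-L2-t11's `kummerOut` /
  canonical `DK₀`, at which `monoThetaEnvCompat_canonical` is the instance form of record).
HONEST FRAMING: statements about OUR typed predicate at a degenerate datum that is NOT the tempered Frobenioid of a
curve; nothing of [EtTh] is asserted or refuted; no FACT-LIST row is thereby proved (R5: named instances only);
typed ≠ proved; nothing here bears on [IUTchIII] Cor. 3.12 and no side is taken on any disputed claim.
-/

noncomputable section

namespace Literature.AnabelianGeometry.EtaleTheta

open CategoryTheory Literature.AlgebraicGeometry.Frobenioids

namespace Sec5Toy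

variable {ψY : datum.PiX ≃ₜ* datum.PiX}

/-! ### Stabilised subgroups: membership transport along `ψY` and `ψY⁻¹` -/

/-- If `ψY` stabilises `K` then `ψY y ∈ K` for `y ∈ K`. [cite: MochizukiEtTh2009, Thm 5.10 (iii) p.334 (PDF p.108)] -/
theorem apply_mem_of_map_eq {K : Subgroup datum.PiX} (hK : K.map ψY.toMulEquiv.toMonoidHom = K)
    {y : datum.PiX} (hy : y ∈ K) : ψY y ∈ K :=
  hK.le ⟨y, hy, rfl⟩

/-- If `ψY` stabilises `K` then `ψY⁻¹ y ∈ K` for `y ∈ K`. [cite: MochizukiEtTh2009, Thm 5.10 (iii) p.334 (PDF p.108)] -/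
theorem symm_apply_mem_of_map_eq {K : Subgroup datum.PiX} (hK : K.map ψY.toMulEquiv.toMonoidHom = K)
    {y : datum.PiX} (hy : y ∈ K) : ψY.symm y ∈ K := by
  obtain ⟨z, hz, hzy⟩ := hK.ge hy
  have : ψY.symm y = z := by
    rw [ContinuousMulEquiv.symm_apply_eq]
    exact hzy.symm
  rw [this]
  exact hz

/-! ### The lift of `ψY` to `E^Π_N ≅ Π^tp_Y̲` -/

/-- For `ψY` stabilising `Π^tp_Y̲`, `(e, y) ↦ (e, ψY y)` preserves `E^Π_N` at the degenerate datum.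
[cite: MochizukiEtTh2009, Thm 5.10 (iii) p.335 (PDF p.109)] -/
theorem lift_mem_EPiN (hY : datum.PiY.map ψY.toMulEquiv.toMonoidHom = datum.PiY) (x : datum.EPiN) :
    ((x : Aut datum.BN × datum.PiX).1, ψY (x : Aut datum.BN × datum.PiX).2) ∈ datum.EPiN :=
  haveI := subsingleton_aut_base_BN
  ⟨x.2.1, apply_mem_of_map_eq hY x.2.2.1, Subsingleton.elim _ _⟩

/-- For `ψY` stabilising `Π^tp_Y̲`, `(e, y) ↦ (e, ψY⁻¹ y)` preserves `E^Π_N` at the degenerate datum.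
[cite: MochizukiEtTh2009, Thm 5.10 (iii) p.335 (PDF p.109)] -/
theorem lift_symm_mem_EPiN (hY : datum.PiY.map ψY.toMulEquiv.toMonoidHom = datum.PiY) (x : datum.EPiN) :
    ((x : Aut datum.BN × datum.PiX).1, ψY.symm (x : Aut datum.BN × datum.PiX).2) ∈ datum.EPiN :=
  haveI := subsingleton_aut_base_BN
  ⟨x.2.1, symm_apply_mem_of_map_eq hY x.2.2.1, Subsingleton.elim _ _⟩

/-- **The lift `liftEnv ψY`** of an automorphism `ψY` of `Π^tp_X̲` stabilising `Π^tp_Y̲` to a bi-continuous automorphism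
of `E^Π_N` at the degenerate datum: `(e, y) ↦ (e, ψY y)` (cf. abc-iut-L2-d4's `envMulEquiv` for compatible pairs
`(Φ, ψ)`; here `Φ = id` on the trivial `Aut_C(B_N)`).  [cite: MochizukiEtTh2009, Thm 5.10 (iii) p.335 (PDF p.109)] -/
def liftEnv (ψY : datum.PiX ≃ₜ* datum.PiX) (hY : datum.PiY.map ψY.toMulEquiv.toMonoidHom = datum.PiY) :
    datum.EPiN ≃ₜ* datum.EPiN where
  toFun x := ⟨_, lift_mem_EPiN hY x⟩
  invFun x := ⟨_, lift_symm_mem_EPiN hY x⟩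
  left_inv _ := Subtype.ext (Prod.ext rfl (ψY.symm_apply_apply _))
  right_inv _ := Subtype.ext (Prod.ext rfl (ψY.apply_symm_apply _))
  map_mul' _ _ := Subtype.ext (Prod.ext rfl (map_mul ψY _ _))
  continuous_toFun := ThetaFrobenioid.continuous_of_componentwise _ id (fun y => ψY y) ψY.continuous fun _ => rfl
  continuous_invFun :=
    ThetaFrobenioid.continuous_of_componentwise _ id (fun y => ψY.symm y) ψY.symm.continuous fun _ => rfl

/-- `liftEnv ψY` on the `Π^tp_X̲`-coordinate. [cite: MochizukiEtTh2009, Thm 5.10 (iii) p.335 (PDF p.109)] -/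
@[simp] theorem toPiY_liftEnv (hY : datum.PiY.map ψY.toMulEquiv.toMonoidHom = datum.PiY) (x : datum.EPiN) :
    datum.toPiY (liftEnv ψY hY x) = ψY (datum.toPiY x) := rfl

/-! ### `D = ⟨DK⟩` at the degenerate datum -/

/-- Conjugation by an element of the normaliser of `E^Π_N` in the ABELIAN ambient group `Aut_C(B_N) × Π^tp_X̲` is the
trivial outer (indeed the trivial) automorphism of `E^Π_N` — so `galOut` (Lemma 5.9 (iii)) and `constOut`
(Lemma 5.8) consist of `1` only.  [cite: MochizukiEtTh2009, Lem 5.9 (iii) p.332 (PDF p.106)] -/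
theorem conjOut_eq_one (n : Subgroup.normalizer (datum.EPiN : Set (Aut datum.BN × datum.PiX))) :
    datum.conjOut n = 1 := by
  have h : (⟨datum.EPiN.normalizerMonoidHom n, datum.normalizerMonoidHom_mem_contMulAut n⟩ :
      contMulAut datum.EPiN) = 1 := by
    apply Subtype.ext
    apply MulEquiv.ext
    intro x
    apply Subtype.ext
    change (n : Aut datum.BN × datum.PiX) * (x : Aut datum.BN × datum.PiX) * (n : Aut datum.BN × datum.PiX)⁻¹ =
      (x : Aut datum.BN × datum.PiX)
    rw [ambient_comm (n : Aut datum.BN × datum.PiX), mul_inv_cancel_right]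
  change TopOut.mk _ _ = 1
  rw [h, map_one]

/-- **`D = ⟨DK⟩`** at the degenerate datum: the subgroup `D ⊆ Out(E^Π_N)` of the Frobenioid-theoretic mono-theta
environment data is generated by the free Kummer part alone.  [cite: MochizukiEtTh2009, Lem 5.9 (iv) p.332 (PDF p.106)] -/
theorem frdD_eq_closure (h1 : datum.SectionsFactor) (h3 : datum.OuterActionLZ) (hsec : datum.SgpCapSection)
    (hcs : datum.SgpCupSection) (h8 : datum.ConstantsEqNormalizer) (DK : Set (TopOut datum.EPiN)) :
    (datum.frdMonoThetaEnv h1 h3 hsec hcs h8 DK).D = Subgroup.closure DK := by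
  change Subgroup.closure (datum.galOut h3 hsec ∪ datum.constOut h8 ∪ DK) = Subgroup.closure DK
  apply le_antisymm
  · rw [Subgroup.closure_le]
    rintro d ((⟨g, rfl⟩ | ⟨u, rfl⟩) | hd)
    · dsimp only
      rw [conjOut_eq_one]
      exact Subgroup.one_mem _
    · dsimp only
      rw [conjOut_eq_one]
      exact Subgroup.one_mem _
    · exact Subgroup.subset_closure hd
  · exact Subgroup.closure_mono Set.subset_union_right

/-! ### `s^Θ = { {x | x̄ ∈ Π^tp_Ÿ̲} }` at the degenerate datum, and it is preserved by every lift -/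

/-- Conjugating a subgroup of the abelian `E^Π_N` does nothing. [cite: MochizukiEtTh2009, Lem 5.9 (iv) p.332 (PDF p.106)] -/
theorem map_conj_eq (H : Subgroup datum.EPiN) (g : datum.EPiN) : H.map (MulAut.conj g).toMonoidHom = H := by
  ext x
  constructor
  · rintro ⟨y, hy, rfl⟩
    change MulAut.conj g y ∈ H
    rwa [conj_EPiN_apply]
  · intro hx
    exact ⟨x, hx, conj_EPiN_apply g x⟩

/-- A `μ_N`-conjugacy class of subgroups of `E^Π_N` is a singleton at the degenerate datum.
[cite: MochizukiEtTh2009, Lem 5.9 (iv) p.332 (PDF p.106)] -/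
theorem muConjClass_eq_singleton (H : Subgroup datum.EPiN) : datum.muConjClass H = {H} := by
  ext K
  constructor
  · rintro ⟨u, rfl⟩
    exact map_conj_eq H _
  · rintro rfl
    exact ⟨⟨1, Subgroup.one_mem _⟩, (map_conj_eq _ _).symm⟩

/-- The image of `s^⊔-Π_N` is `{x ∈ E^Π_N | x̄ ∈ Π^tp_Ÿ̲}` at the degenerate datum.
[cite: MochizukiEtTh2009, Lem 5.9 (iv) p.332 (PDF p.106)] -/
theorem mem_range_sCupPi_iff (h1 : datum.SectionsFactor) (hcs : datum.SgpCupSection) (x : datum.EPiN) :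
    x ∈ (datum.sCupPi h1 hcs).range ↔ datum.toPiY x ∈ datum.PiYdd := by
  constructor
  · rintro ⟨h, rfl⟩
    exact h.2
  · intro hx
    exact ⟨⟨datum.toPiY x, hx⟩, EPiN_ext rfl⟩

/-- The lift of a `ψY` stabilising `Π^tp_Ÿ̲` stabilises the image of `s^⊔-Π_N`.
[cite: MochizukiEtTh2009, Thm 5.10 (iii) p.334 (PDF p.108)] -/
theorem map_range_sCupPi_liftEnv (h1 : datum.SectionsFactor) (hcs : datum.SgpCupSection)
    (hY : datum.PiY.map ψY.toMulEquiv.toMonoidHom = datum.PiY)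
    (hYdd : datum.PiYdd.map ψY.toMulEquiv.toMonoidHom = datum.PiYdd) :
    (datum.sCupPi h1 hcs).range.map (liftEnv ψY hY).toMulEquiv.toMonoidHom = (datum.sCupPi h1 hcs).range := by
  ext x
  constructor
  · rintro ⟨y, hy, rfl⟩
    rw [SetLike.mem_coe, mem_range_sCupPi_iff] at hy
    rw [mem_range_sCupPi_iff]
    exact apply_mem_of_map_eq hYdd hy
  · intro hx
    rw [mem_range_sCupPi_iff] at hx
    refine ⟨(liftEnv ψY hY).symm x, ?_, ContinuousMulEquiv.apply_symm_apply _ _⟩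
    rw [SetLike.mem_coe, mem_range_sCupPi_iff]
    exact symm_apply_mem_of_map_eq hYdd hx

/-! ### The criterion -/

section Criterion

/-- **Uniqueness of `γ`**: at the degenerate datum any automorphism of the mono-theta environment data lying over
(a `Π^tp_X̲`-conjugate of) `ψY` on `Π^tp_Y̲` IS the lift `liftEnv ψY`.  [cite: MochizukiEtTh2009, Thm 5.10 (iii) p.334 (PDF p.108)] -/
theorem iso_e_eq_liftEnv (h1 : datum.SectionsFactor) (h3 : datum.OuterActionLZ) (hsec : datum.SgpCapSection)
    (hcs : datum.SgpCupSection) (h8 : datum.ConstantsEqNormalizer) (DK : Set (TopOut datum.EPiN))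
    (ψY : datum.PiX ≃ₜ* datum.PiX) (hY : datum.PiY.map ψY.toMulEquiv.toMonoidHom = datum.PiY) (x₃ : datum.PiX)
    (γ : (datum.frdMonoThetaEnv h1 h3 hsec hcs h8 DK).Iso (datum.frdMonoThetaEnv h1 h3 hsec hcs h8 DK))
    (hγ : ∀ x : datum.EPiN, datum.toPiY (γ.e x) = x₃⁻¹ * ψY (datum.toPiY x) * x₃) :
    γ.e = liftEnv ψY hY :=
  ContinuousMulEquiv.ext fun x =>
    EPiN_ext ((hγ x).trans ((conj_PiX x₃ _).trans (toPiY_liftEnv hY x).symm))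

/-- The automorphism of the mono-theta environment data determined by `liftEnv ψY` WHEN it normalises `⟨DK⟩`.
[cite: MochizukiEtTh2009, Thm 5.10 (iii) p.334 (PDF p.108)] -/
def isoOfLift (h1 : datum.SectionsFactor) (h3 : datum.OuterActionLZ) (hsec : datum.SgpCapSection)
    (hcs : datum.SgpCupSection) (h8 : datum.ConstantsEqNormalizer) (DK : Set (TopOut datum.EPiN))
    (ψY : datum.PiX ≃ₜ* datum.PiX) (hY : datum.PiY.map ψY.toMulEquiv.toMonoidHom = datum.PiY)
    (hYdd : datum.PiYdd.map ψY.toMulEquiv.toMonoidHom = datum.PiYdd)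
    (hD : (Subgroup.closure DK).map (TopOut.transport (liftEnv ψY hY)) = Subgroup.closure DK) :
    (datum.frdMonoThetaEnv h1 h3 hsec hcs h8 DK).Iso (datum.frdMonoThetaEnv h1 h3 hsec hcs h8 DK) where
  e := liftEnv ψY hY
  map_D := by rw [frdD_eq_closure]; exact hD
  map_sTheta := by
    change (fun H : Subgroup datum.EPiN => H.map (liftEnv ψY hY).toMulEquiv.toMonoidHom) ''
        datum.muConjClass (datum.sCupPi h1 hcs).range = datum.muConjClass (datum.sCupPi h1 hcs).range
    rw [muConjClass_eq_singleton, Set.image_singleton, map_range_sCupPi_liftEnv h1 hcs hY hYdd]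

/-- **CRITERION (F-0547 at the degenerate datum).**  For all §5 inputs, every Kummer part `DK`, every `Ψ`, `β`
and every `ψY` stabilising `Π^tp_Y̲`, `Π^tp_Ÿ̲` (it lies over `Ψ^Aut` automatically): the typed Theorem 5.10 (iii)
statement holds IFF the `Out`-transport along the lift of `ψY` stabilises `⟨DK⟩` (= `D` here).
[cite: MochizukiEtTh2009, Thm 5.10 (iii) p.334 (PDF p.108)] -/
theorem monoThetaEnvCompat_datum_iff (h1 : datum.SectionsFactor) (h3 : datum.OuterActionLZ) (hsec : datum.SgpCapSection)
    (hcs : datum.SgpCupSection) (h8 : datum.ConstantsEqNormalizer) (DK : Set (TopOut datum.EPiN))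
    (Ψ : Discrete PUnit.{1} ≌ Discrete PUnit.{1}) (β : Ψ.functor.obj datum.BN ≅ datum.BN)
    (ψY : datum.PiX ≃ₜ* datum.PiX) (hY : datum.PiY.map ψY.toMulEquiv.toMonoidHom = datum.PiY)
    (hYdd : datum.PiYdd.map ψY.toMulEquiv.toMonoidHom = datum.PiYdd) :
    datum.MonoThetaEnvCompat h1 h3 hsec hcs h8 DK Ψ β ψY (hbase_datum Ψ β ψY) hY hYdd ↔
      (Subgroup.closure DK).map (TopOut.transport (liftEnv ψY hY)) = Subgroup.closure DK := by
  constructor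
  · rintro ⟨x₃, γ, -, -, hγ⟩
    have he := iso_e_eq_liftEnv h1 h3 hsec hcs h8 DK ψY hY x₃ γ hγ
    have hD := γ.map_D
    rw [he, frdD_eq_closure] at hD
    exact hD
  · intro hD
    haveI := subsingleton_aut_BN
    refine ⟨1, isoOfLift h1 h3 hsec hcs h8 DK ψY hY hYdd hD, 1, fun _ => Subsingleton.elim _ _, fun x => ?_⟩
    change datum.toPiY (liftEnv ψY hY x) = 1⁻¹ * ψY (datum.toPiY x) * 1
    rw [toPiY_liftEnv, inv_one, one_mul, mul_one]

/-- **F-0547 HOLDS at the degenerate datum for `DK = ∅` and EVERY admissible `ψY`** (print's `D` has no free part):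
`D = ⟨∅⟩ = 1` is stabilised by anything.  [cite: MochizukiEtTh2009, Thm 5.10 (iii) p.334 (PDF p.108)] -/
theorem monoThetaEnvCompat_datum_empty (h1 : datum.SectionsFactor) (h3 : datum.OuterActionLZ)
    (hsec : datum.SgpCapSection) (hcs : datum.SgpCupSection) (h8 : datum.ConstantsEqNormalizer)
    (Ψ : Discrete PUnit.{1} ≌ Discrete PUnit.{1}) (β : Ψ.functor.obj datum.BN ≅ datum.BN)
    (ψY : datum.PiX ≃ₜ* datum.PiX) (hY : datum.PiY.map ψY.toMulEquiv.toMonoidHom = datum.PiY)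
    (hYdd : datum.PiYdd.map ψY.toMulEquiv.toMonoidHom = datum.PiYdd) :
    datum.MonoThetaEnvCompat h1 h3 hsec hcs h8 ∅ Ψ β ψY (hbase_datum Ψ β ψY) hY hYdd := by
  rw [monoThetaEnvCompat_datum_iff, Subgroup.closure_empty, Subgroup.map_bot]

/-- **F-0547 HOLDS at the degenerate datum for `DK = Out(E^Π_N)` and EVERY admissible `ψY`**: `D = Out(E^Π_N)` is
stabilised by the (surjective) transport.  [cite: MochizukiEtTh2009, Thm 5.10 (iii) p.334 (PDF p.108)] -/
theorem monoThetaEnvCompat_datum_univ (h1 : datum.SectionsFactor) (h3 : datum.OuterActionLZ)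
    (hsec : datum.SgpCapSection) (hcs : datum.SgpCupSection) (h8 : datum.ConstantsEqNormalizer)
    (Ψ : Discrete PUnit.{1} ≌ Discrete PUnit.{1}) (β : Ψ.functor.obj datum.BN ≅ datum.BN)
    (ψY : datum.PiX ≃ₜ* datum.PiX) (hY : datum.PiY.map ψY.toMulEquiv.toMonoidHom = datum.PiY)
    (hYdd : datum.PiYdd.map ψY.toMulEquiv.toMonoidHom = datum.PiYdd) :
    datum.MonoThetaEnvCompat h1 h3 hsec hcs h8 Set.univ Ψ β ψY (hbase_datum Ψ β ψY) hY hYdd := by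
  rw [monoThetaEnvCompat_datum_iff, Subgroup.closure_univ]
  exact Subgroup.map_top_of_surjective _ fun d =>
    ⟨_, ThetaFrobenioid.transport_transport_symm_apply (liftEnv ψY hY) d⟩

end Criterion

/-- … whereas for `DK := {[negB]}` and `ψY := shear` it FAILS (p432975, `not_monoThetaEnvCompat_datum`), read
through the criterion: the transport along the lift of the shear does NOT stabilise `⟨[negB]⟩`.  So at this datum
the counterexample to the ∀-closure of F-0547 is carried exactly by the free Kummer part `DK`.
[cite: MochizukiEtTh2009, Thm 5.10 (iii) p.334 (PDF p.108)] -/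
theorem not_map_closure_negBOut_shear :
    (Subgroup.closure {negBOut}).map (TopOut.transport (liftEnv shearTop map_PiY_shearTop)) ≠
      Subgroup.closure {negBOut} := fun h =>
  not_monoThetaEnvCompat_datum facts_datum.sectionsFactor datum.outerActionLZ_of facts_datum.sgpCapSection
    facts_datum.sgpCupSection facts_datum.constantsEqNormalizer
    (CategoryTheory.Equivalence.refl : Discrete PUnit.{1} ≌ Discrete PUnit.{1}) (Iso.refl _)
    ((monoThetaEnvCompat_datum_iff _ _ _ _ _ {negBOut} _ _ shearTop map_PiY_shearTop map_PiYdd_shearTop).mpr h)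

end Sec5Toy

end Literature.AnabelianGeometry.EtaleTheta
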